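import Mathlib
import Literature.MathematicalPhysics.QuantumLattice.GaugeGroups
import Literature.MathematicalPhysics.QuantumFieldTheory.ConstructiveQFTWave0
import Literature.MathematicalPhysics.QuantumFieldTheory.CircleHaarAngle
import Literature.MathematicalPhysics.QuantumFieldTheory.U1GinibreComparison
import Summits.Ventures.LatticeQCDFlow.Scaling.LatticeEntropy
import Summits.Ventures.LatticeQCDFlow.Scaling.LatticeEntropyGrowth
import Summits.Ventures.LatticeQCDFlow.Scaling.LatticeEntropyGrowthSharp

/-!
# LatticeQCDFlow / Scaling — the `U(1)` instance of the entropy-growth law (R-T2-10, one-plaquette inputs)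

HONEST FRAMING: exact (Metropolis-corrected) sampling algorithms for lattice gauge theory; figures of merit are
autocorrelation/cost numbers at stated couplings and volumes; no continuum-physics claim.

Venture `LatticeQCDFlow` (cell pub-lqcd), topic `Scaling`, FANOUT row 30 (lean-1) — OUR WORK closing the
"one-plaquette inputs (H1)/(H2) as instances" item of THEORY-2.md §4 T2-AH / R-T2-10 for the compact abelian
gauge group `U(1) = Circle` with its defining representation `u1Rep` (`GaugeGroups.lean`).  The tree's
`crudeEntropyGrowth d κ` (`Scaling/LatticeEntropyGrowth.lean`) proves the two-sided `V·log β` law for the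
relative entropy of the Wilson measure with respect to the product Haar prior CONDITIONALLY on two
one-plaquette hypotheses; its docstring records that "no vacuous instance is claimed".  Here both hypotheses
are PROVED for `U(1)` (`κ = 1`), so the law holds outright for compact `U(1)` lattice gauge theory in every
dimension:

* (H1) `onePlaquetteZ_u1Rep_le`: `Z₁(β) = (2π)⁻¹ ∫_{-π}^{π} e^{-β(1 - cos θ)} dθ ≤ √(π/8)·β^{-1/2}` for
  `β > 0` (Jordan's inequality `1 - cos θ ≥ 2θ²/π²` on `[-π, π]`, then the Gaussian integral);
* (H2) `smallBall_u1`: the arc `B_ε = {e^{iθ} : |θ| ≤ ε}` (`0 < ε ≤ 1`) has Haar mass `≥ ε/π` and every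
  product of four elements of `{1} ∪ B_ε ∪ B_ε⁻¹` has plaquette action `1 - cos(·) ≤ 8ε²`;
* `crudeEntropyGrowth_u1`: for every `d` there is `C` with, for all `L ≥ 2`, `β ≥ 1`,
  `L^d·((d-2)/2 - (d-1)/L)·log β - C·L^d ≤ D(μ_{Λ,β}^{U(1)} ‖ Haar^{⊗E}) ≤ (d·L^d/2)·log β + C·L^d`.

The Haar-measure-in-angles dictionary is the tree's `CircleHaarAngle.lean`
(`CircleHaar.integral_haarProbability_circle`, `CircleHaar.map_exp_angleMeasure`; Borel structure on
`Circle` from `GrassmannIntegral.lean`; `trace_u1Rep_re` from `U1GinibreComparison.lean`).  Elementary; nothing here is cited as a fact.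
-/

noncomputable section

open MeasureTheory Real Set
open Literature.MathematicalPhysics.QuantumFieldTheory
open Literature.MathematicalPhysics.QuantumLattice (u1Rep u1Rep_apply continuous_u1Rep)

namespace Summit.Ventures.LatticeQCDFlow.Theory2.Lattice.U1

/-! ## §1. The one-plaquette integrand of `U(1)` in the angle variable -/

/-- `Re tr u1Rep(z) ≤ 1` (points of the unit circle). [folklore] -/
theorem re_trace_u1Rep_le (z : Circle) : (u1Rep z).trace.re ≤ (1 : ℕ) := by
  rw [trace_u1Rep_re, Nat.cast_one]
  have h := Complex.abs_re_le_norm (z : ℂ)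
  rw [Circle.norm_coe] at h
  exact (le_abs_self _).trans h

/-- `Re e^{iθ} = cos θ`. [folklore] -/
theorem re_coe_exp (θ : ℝ) : ((Circle.exp θ : Circle) : ℂ).re = Real.cos θ := by
  rw [Circle.coe_exp]
  exact Complex.exp_ofReal_mul_I_re θ

/-- The one-plaquette partition function of `U(1)` in angles:
`Z₁(β) = (2π)⁻¹ ∫_{(-π,π]} e^{-β(1 - cos θ)} dθ`. [folklore] -/
theorem onePlaquetteZ_u1Rep_eq (β : ℝ) :
    onePlaquetteZ u1Rep β = (2 * π)⁻¹ * ∫ θ in Ioc (-π) π, Real.exp (-(β * (1 - Real.cos θ))) := by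
  have hcont : Continuous fun z : Circle => Real.exp (-(β * ((1 : ℕ) - (u1Rep z).trace.re))) :=
    Real.continuous_exp.comp (continuous_const.mul (continuous_const.sub
      (Complex.continuous_re.comp continuous_u1Rep.matrix_trace))).neg
  unfold onePlaquetteZ
  rw [← integral_eq_lintegral_of_nonneg_ae (Filter.Eventually.of_forall fun z => (Real.exp_pos _).le)
    hcont.aestronglyMeasurable, CircleHaar.integral_haarProbability_circle _ hcont.aestronglyMeasurable,
    smul_eq_mul]
  congr 1
  refine setIntegral_congr_fun measurableSet_Ioc fun θ _ => ?_
  simp only [trace_u1Rep_re, re_coe_exp, Nat.cast_one]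

/-! ## §2. (H1): `Z₁(β) ≤ √(π/8) · β^{-1/2}` -/

/-- **Jordan-type bound**: `2θ²/π² ≤ 1 - cos θ` for `|θ| ≤ π` (`1 - cos θ = 2 sin²(θ/2)` and
`|sin x| ≥ (2/π)|x|` on `[-π/2, π/2]`). [folklore] -/
theorem two_mul_sq_div_le_one_sub_cos {θ : ℝ} (hθ : |θ| ≤ π) :
    2 * θ ^ 2 / π ^ 2 ≤ 1 - Real.cos θ := by
  have hkey : 1 - Real.cos θ = 2 * Real.sin (θ / 2) ^ 2 := by
    have h := Real.sin_sq_eq_half_sub (θ / 2)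
    rw [show 2 * (θ / 2) = θ by ring] at h
    linarith
  rw [hkey]
  -- `|sin (θ/2)| ≥ |θ|/π`
  have hhalf : |θ / 2| ≤ π / 2 := by rw [abs_div, abs_two]; linarith
  have hsin : |θ| / π ≤ |Real.sin (θ / 2)| := by
    have hx : 0 ≤ |θ / 2| := abs_nonneg _
    have h := Real.mul_le_sin hx hhalf
    -- `|sin |x|| = |sin x|`
    have hs : |Real.sin (|θ / 2|)| = |Real.sin (θ / 2)| := by
      rcases le_total 0 (θ / 2) with h0 | h0
      · rw [abs_of_nonneg h0]
      · rw [abs_of_nonpos h0, Real.sin_neg, abs_neg]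
    calc |θ| / π = 2 / π * |θ / 2| := by rw [abs_div, abs_two]; ring
      _ ≤ Real.sin (|θ / 2|) := h
      _ ≤ |Real.sin (|θ / 2|)| := le_abs_self _
      _ = |Real.sin (θ / 2)| := hs
  have hπ : 0 < π := Real.pi_pos
  have h2 : (|θ| / π) ^ 2 ≤ |Real.sin (θ / 2)| ^ 2 :=
    pow_le_pow_left₀ (div_nonneg (abs_nonneg _) hπ.le) hsin 2
  rw [sq_abs, div_pow, sq_abs] at h2
  calc 2 * θ ^ 2 / π ^ 2 = 2 * (θ ^ 2 / π ^ 2) := by ring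
    _ ≤ 2 * Real.sin (θ / 2) ^ 2 := by linarith

/-- **(H1) for `U(1)`**: `Z₁(β) ≤ √(π/8)·β^{-1/2}` for `β > 0` — the one-plaquette partition function of
`U(1)` decays like `β^{-dim U(1)/2}`. [folklore] -/
theorem onePlaquetteZ_u1Rep_le {β : ℝ} (hβ : 0 < β) :
    onePlaquetteZ u1Rep β ≤ Real.sqrt (π / 8) * β ^ (-((1 : ℝ) / 2)) := by
  rw [onePlaquetteZ_u1Rep_eq]
  set c : ℝ := 2 * β / π ^ 2 with hc
  have hπ : 0 < π := Real.pi_pos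
  have hcpos : 0 < c := by rw [hc]; positivity
  -- pointwise comparison with a Gaussian on `(-π, π]`
  have hpt : ∀ θ ∈ Ioc (-π) π, Real.exp (-(β * (1 - Real.cos θ))) ≤ Real.exp (-c * θ ^ 2) := by
    intro θ hθ
    refine Real.exp_le_exp.2 ?_
    have habs : |θ| ≤ π := abs_le.2 ⟨hθ.1.le, hθ.2⟩
    have h := two_mul_sq_div_le_one_sub_cos habs
    have h' : β * (2 * θ ^ 2 / π ^ 2) ≤ β * (1 - Real.cos θ) := mul_le_mul_of_nonneg_left h hβ.le
    rw [hc]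
    have : 2 * β / π ^ 2 * θ ^ 2 = β * (2 * θ ^ 2 / π ^ 2) := by ring
    linarith
  have hcontf : Continuous fun θ : ℝ => Real.exp (-(β * (1 - Real.cos θ))) :=
    Real.continuous_exp.comp (continuous_const.mul (continuous_const.sub Real.continuous_cos)).neg
  have hint_f : IntegrableOn (fun θ => Real.exp (-(β * (1 - Real.cos θ)))) (Ioc (-π) π) :=
    (hcontf.integrableOn_Icc (a := -π) (b := π)).mono_set Ioc_subset_Icc_self
  have hgauss : Integrable (fun θ : ℝ => Real.exp (-c * θ ^ 2)) := integrable_exp_neg_mul_sq hcpos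
  have h1 : ∫ θ in Ioc (-π) π, Real.exp (-(β * (1 - Real.cos θ))) ≤
      ∫ θ in Ioc (-π) π, Real.exp (-c * θ ^ 2) :=
    setIntegral_mono_on hint_f hgauss.integrableOn measurableSet_Ioc hpt
  have h2 : ∫ θ in Ioc (-π) π, Real.exp (-c * θ ^ 2) ≤ ∫ θ, Real.exp (-c * θ ^ 2) :=
    setIntegral_le_integral hgauss (Filter.Eventually.of_forall fun θ => (Real.exp_pos _).le)
  rw [integral_gaussian c] at h2
  -- the constant: `(2π)⁻¹ √(π/c) = √(π/8) β^{-1/2}`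
  have hβs : β ^ (-((1 : ℝ) / 2)) = (Real.sqrt β)⁻¹ := by
    rw [Real.rpow_neg hβ.le, ← Real.sqrt_eq_rpow]
  have hsq1 : Real.sqrt (π / c) = π * (Real.sqrt (π / 2) / Real.sqrt β) := by
    rw [hc, show π / (2 * β / π ^ 2) = π ^ 2 * (π / 2 / β) by field_simp, Real.sqrt_mul (sq_nonneg π),
      Real.sqrt_sq hπ.le, Real.sqrt_div (by positivity) β]
  have h4 : Real.sqrt 4 = 2 := by
    rw [show (4 : ℝ) = 2 * 2 by norm_num, Real.sqrt_mul_self zero_le_two]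
  have hsq2 : Real.sqrt (π / 8) = Real.sqrt (π / 2) / 2 := by
    rw [show π / 8 = π / 2 / 4 by ring, Real.sqrt_div (by positivity) 4, h4]
  have hsβ : Real.sqrt β ≠ 0 := (Real.sqrt_pos.2 hβ).ne'
  have hval : (2 * π)⁻¹ * Real.sqrt (π / c) = Real.sqrt (π / 8) * β ^ (-((1 : ℝ) / 2)) := by
    rw [hsq1, hsq2, hβs]
    field_simp
  calc (2 * π)⁻¹ * ∫ θ in Ioc (-π) π, Real.exp (-(β * (1 - Real.cos θ)))
      ≤ (2 * π)⁻¹ * Real.sqrt (π / c) :=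
        mul_le_mul_of_nonneg_left (h1.trans h2) (by positivity)
    _ = Real.sqrt (π / 8) * β ^ (-((1 : ℝ) / 2)) := hval

/-! ## §3. (H2): small arcs of the circle -/

/-- The arc `B_ε = {e^{iθ} : |θ| ≤ ε}`. [folklore] -/
def arc (ε : ℝ) : Set Circle := Circle.exp '' Icc (-ε) ε

/-- The arc is compact, hence measurable. [folklore] -/
theorem measurableSet_arc (ε : ℝ) : MeasurableSet (arc ε) :=
  (isCompact_Icc.image Circle.exp.continuous).measurableSet

/-- **Haar mass of the arc**: `Haar(B_ε) ≥ ε/π` for `0 < ε ≤ 1` (in fact `= ε/π`). [folklore] -/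
theorem haar_arc_ge {ε : ℝ} (hε : 0 < ε) (hε1 : ε ≤ 1) :
    1 / π * ε ^ (1 : ℝ) ≤ (haarProbability Circle (arc ε)).toReal := by
  have hπ : 0 < π := Real.pi_pos
  have hεπ : ε < π := lt_of_le_of_lt hε1 (by linarith [Real.pi_gt_three])
  rw [Real.rpow_one, ← CircleHaar.map_exp_angleMeasure,
    Measure.map_apply Circle.exp.continuous.measurable (measurableSet_arc ε)]
  -- `Icc (-ε) ε ⊆ exp⁻¹' B_ε`, and its angle measure is `2ε/(2π)`
  have hsub : Icc (-ε) ε ⊆ Circle.exp ⁻¹' arc ε := fun θ hθ => ⟨θ, hθ, rfl⟩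
  have hmass : CircleHaar.angleMeasure (Icc (-ε) ε) = ENNReal.ofReal (ε / π) := by
    rw [CircleHaar.angleMeasure, Measure.smul_apply, Measure.restrict_apply measurableSet_Icc,
      Set.inter_eq_left.2 (Icc_subset_Ioc_iff (by linarith) |>.2 ⟨by linarith, hεπ.le⟩ |>
        fun h => h), Real.volume_Icc, smul_eq_mul,
      show ε - -ε = 2 * ε by ring, ← ENNReal.ofReal_inv_of_pos (by positivity),
      ← ENNReal.ofReal_mul (by positivity)]
    congr 1
    field_simp
  have hle : ENNReal.ofReal (ε / π) ≤ CircleHaar.angleMeasure (Circle.exp ⁻¹' arc ε) := by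
    rw [← hmass]; exact measure_mono hsub
  have hfin : CircleHaar.angleMeasure (Circle.exp ⁻¹' arc ε) ≠ ⊤ := measure_ne_top _ _
  have := ENNReal.toReal_mono hfin hle
  rwa [ENNReal.toReal_ofReal (by positivity), show ε / π = 1 / π * ε by ring] at this

/-- Elements of `{1} ∪ B_ε ∪ B_ε⁻¹` are `e^{iθ}` with `|θ| ≤ ε` (`ε ≥ 0`). [folklore] -/
theorem exists_angle_of_mem {ε : ℝ} (hε : 0 ≤ ε) {g : Circle}
    (hg : g ∈ insert (1 : Circle) (arc ε ∪ (arc ε)⁻¹)) : ∃ θ : ℝ, |θ| ≤ ε ∧ g = Circle.exp θ := by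
  rcases hg with rfl | hg | hg
  · exact ⟨0, by rw [abs_zero]; exact hε, by rw [Circle.exp_zero]⟩
  · obtain ⟨θ, hθ, rfl⟩ := hg
    exact ⟨θ, abs_le.2 ⟨hθ.1, hθ.2⟩, rfl⟩
  · rw [Set.mem_inv] at hg
    obtain ⟨θ, hθ, hθg⟩ := hg
    refine ⟨-θ, by rw [abs_neg]; exact abs_le.2 ⟨hθ.1, hθ.2⟩, ?_⟩
    rw [Circle.exp_neg, hθg, inv_inv]

/-- **(H2) for `U(1)`, plaquette part**: a product of four elements of `{1} ∪ B_ε ∪ B_ε⁻¹` has action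
`1 - Re tr ≤ 8ε²` (`= 1 - cos(θ₁+θ₂+θ₃+θ₄) ≤ (4ε)²/2`). [folklore] -/
theorem action_fourfold_le {ε : ℝ} (hε : 0 ≤ ε) {g₁ g₂ g₃ g₄ : Circle}
    (h₁ : g₁ ∈ insert (1 : Circle) (arc ε ∪ (arc ε)⁻¹)) (h₂ : g₂ ∈ insert (1 : Circle) (arc ε ∪ (arc ε)⁻¹))
    (h₃ : g₃ ∈ insert (1 : Circle) (arc ε ∪ (arc ε)⁻¹)) (h₄ : g₄ ∈ insert (1 : Circle) (arc ε ∪ (arc ε)⁻¹)) :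
    ((1 : ℕ) : ℝ) - (u1Rep (g₁ * g₂ * g₃ * g₄)).trace.re ≤ 8 * ε ^ 2 := by
  obtain ⟨θ₁, hθ₁, rfl⟩ := exists_angle_of_mem hε h₁
  obtain ⟨θ₂, hθ₂, rfl⟩ := exists_angle_of_mem hε h₂
  obtain ⟨θ₃, hθ₃, rfl⟩ := exists_angle_of_mem hε h₃
  obtain ⟨θ₄, hθ₄, rfl⟩ := exists_angle_of_mem hε h₄
  rw [← Circle.exp_add, ← Circle.exp_add, ← Circle.exp_add, trace_u1Rep_re, re_coe_exp, Nat.cast_one]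
  have hcos := Real.one_sub_sq_div_two_le_cos (x := θ₁ + θ₂ + θ₃ + θ₄)
  have hsum : |θ₁ + θ₂ + θ₃ + θ₄| ≤ 4 * ε := by
    calc |θ₁ + θ₂ + θ₃ + θ₄| ≤ |θ₁ + θ₂ + θ₃| + |θ₄| := abs_add_le _ _
      _ ≤ |θ₁ + θ₂| + |θ₃| + |θ₄| := by linarith [abs_add_le (θ₁ + θ₂) θ₃]
      _ ≤ |θ₁| + |θ₂| + |θ₃| + |θ₄| := by linarith [abs_add_le θ₁ θ₂]
      _ ≤ 4 * ε := by linarith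
  have hsq : (θ₁ + θ₂ + θ₃ + θ₄) ^ 2 ≤ (4 * ε) ^ 2 := by
    rw [← sq_abs]; exact pow_le_pow_left₀ (abs_nonneg _) hsum 2
  nlinarith

/-- **(H2) for `U(1)`**, in the exact form consumed by `CrudeEntropyGrowth` (`κ = 1`, `a = 1/π`, `b = 8`).
[folklore] -/
theorem smallBall_u1 :
    ∃ a b : ℝ, 0 < a ∧ ∀ ε : ℝ, 0 < ε → ε ≤ 1 → ∃ B : Set Circle, MeasurableSet B ∧
      a * ε ^ (1 : ℝ) ≤ (haarProbability Circle B).toReal ∧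
      ∀ g₁ ∈ insert (1 : Circle) (B ∪ B⁻¹), ∀ g₂ ∈ insert (1 : Circle) (B ∪ B⁻¹),
        ∀ g₃ ∈ insert (1 : Circle) (B ∪ B⁻¹), ∀ g₄ ∈ insert (1 : Circle) (B ∪ B⁻¹),
          ((1 : ℕ) : ℝ) - (u1Rep (g₁ * g₂ * g₃ * g₄)).trace.re ≤ b * ε ^ 2 :=
  ⟨1 / π, 8, by positivity, fun ε hε hε1 => ⟨arc ε, measurableSet_arc ε, haar_arc_ge hε hε1,
    fun _ h₁ _ h₂ _ h₃ _ h₄ => action_fourfold_le hε.le h₁ h₂ h₃ h₄⟩⟩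

/-! ## §4. The entropy-growth law for `U(1)` lattice gauge theory, unconditionally -/

/-- **Entropy growth of compact `U(1)` lattice gauge theory** (OURS; the `U(1)` instance of the tree's
`crudeEntropyGrowth`, with both one-plaquette hypotheses discharged): for every dimension `d` there is a
constant `C` such that for all `L ≥ 2` and `β ≥ 1` the relative entropy of the Wilson measure of `U(1)` on
`(ℤ/L)^d` with respect to the product Haar prior satisfies
`L^d·((d-2)/2 - (d-1)/L)·log β - C·L^d ≤ D(μ_{Λ,β} ‖ Haar^{⊗E}) ≤ (d·L^d/2)·log β + C·L^d` — it is
extensive and grows like `V·log β` (lower coefficient positive for `d ≥ 3`, `L > 2(d-1)/(d-2)`).  This is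
the quantity every EXACT flow from the Haar prior must supply as `log M + E log J`
(`Scaling/EntropyBudget.lean`). [folklore] -/
theorem crudeEntropyGrowth_u1 (d : ℕ) :
    ∃ C : ℝ, ∀ (L : ℕ) [NeZero L], 2 ≤ L → ∀ β : ℝ, 1 ≤ β →
      (1 : ℝ) * (L : ℝ) ^ d * (((d : ℝ) - 2) / 2 - ((d : ℝ) - 1) / L) * Real.log β - C * (L : ℝ) ^ d ≤
          (InformationTheory.klDiv (wilsonMeasure (d := d) (L := L) u1Rep β)
              (Measure.pi fun _ : Edge d L => haarProbability Circle)).toReal ∧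
        (InformationTheory.klDiv (wilsonMeasure (d := d) (L := L) u1Rep β)
              (Measure.pi fun _ : Edge d L => haarProbability Circle)).toReal ≤
          1 * ((d : ℝ) * (L : ℝ) ^ d / 2) * Real.log β + C * (L : ℝ) ^ d :=
  crudeEntropyGrowth d 1 1 Circle u1Rep continuous_u1Rep re_trace_u1Rep_le zero_le_one
    ⟨Real.sqrt (π / 8), fun β hβ => by simpa using onePlaquetteZ_u1Rep_le hβ⟩ smallBall_u1

/-! ## §5. The sharp law for `U(1)` (the `U(1)` instance of `entropyGrowth`, typed as an item)

Appended after `Scaling/LatticeEntropyGrowthSharp.lean` (`entropyGrowth : EntropyGrowth d κ`, theory-2 v2.1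
#18) landed: with (H1) `onePlaquetteZ_u1Rep_le` and (H2) `smallBall_u1` above, the SHARP two-sided law holds
for compact `U(1)` lattice gauge theory in every dimension `d`, with the transverse count
`n_tr = (d-1)·L^d` as the coefficient of `(1/2)·log β` on both sides up to `O(1/L)`. -/

/-- **Sharp entropy growth of compact `U(1)` lattice gauge theory** (typed item, OURS; the `U(1)`,
`κ = 1` instance of `EntropyGrowth d κ` of `Scaling/LatticeEntropy.lean` with both one-plaquette
hypotheses discharged): there is `C = C(d)` such that for all `L ≥ 2`, `β ≥ 1`,
`((d-1)·L^d·(1/2 - 1/L) - 1/2)·log β - C·L^d ≤ D(μ_{Λ,β}^{U(1)} ‖ Haar^{⊗E}) ≤ ((d-1)·L^d + 1)/2·log β + C·L^d`.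
Proved below (`u1EntropyGrowth`). [folklore] -/
@[conjecture]
def U1EntropyGrowth (d : ℕ) : Prop :=
  ∃ C : ℝ, ∀ (L : ℕ) [NeZero L], 2 ≤ L → ∀ β : ℝ, 1 ≤ β →
    (((d : ℝ) - 1) * (L : ℝ) ^ d * (1 / 2 - 1 / L) - 1 / 2) * Real.log β - C * (L : ℝ) ^ d ≤
        (InformationTheory.klDiv (wilsonMeasure (d := d) (L := L) u1Rep β)
            (Measure.pi fun _ : Edge d L => haarProbability Circle)).toReal ∧
      (InformationTheory.klDiv (wilsonMeasure (d := d) (L := L) u1Rep β)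
            (Measure.pi fun _ : Edge d L => haarProbability Circle)).toReal ≤
        (((d : ℝ) - 1) * (L : ℝ) ^ d + 1) / 2 * Real.log β + C * (L : ℝ) ^ d

/-- **The sharp entropy-growth law for `U(1)`, unconditionally** (OURS; closes `U1EntropyGrowth`):
`entropyGrowth d 1` fed with `onePlaquetteZ_u1Rep_le` (H1) and `smallBall_u1` (H2). [folklore] -/
theorem u1EntropyGrowth (d : ℕ) : U1EntropyGrowth d := by
  obtain ⟨C, hC⟩ := entropyGrowth d 1 1 Circle u1Rep continuous_u1Rep re_trace_u1Rep_le
    ⟨Real.sqrt (π / 8), fun β hβ => by simpa using onePlaquetteZ_u1Rep_le hβ⟩ smallBall_u1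
  exact ⟨C, fun L _ hL β hβ => by simpa only [one_mul] using hC L hL β hβ⟩

end Summit.Ventures.LatticeQCDFlow.Theory2.Lattice.U1
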